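import Summits.CriticalPhenomena.Ising3DConformalLimit.Theses.EnergyNotSigmaSquared
import Literature.Probability.LatticeModels.CriticalScalingDimension

/-!
# `MoebiusLimit` (item stmt-CriticalPhenomena-1344): the scaling dimension of any witness lies in `[1/2, 1]`

Negative knowledge about the crux `Summit.CriticalPhenomena.Ising3DConformalLimit.Theses.EnergyNotSigmaSquared.MoebiusLimit`
(= `PerfectScreening.MoebiusLimitExists`, the conjunct `CritIsing3DConformalLimit` minus clause (iii)):
the numerical clause `0 < Δ` is far from sharp — every witness `(ρ, Δ, S)` has `1/2 ≤ Δ ≤ 1`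
(tree theorem `Literature.Probability.LatticeModels.scalingDimension_mem_Icc_holds`: infrared bound
and Simon–Lieb lower bound on `ℤ³`), so the strengthenings of the crux pinning `Δ < 1/2` or `1 < Δ`
are FALSE, and the clause `0 < Δ` is redundant. Theorem-only file (standing crux disprover, D-0016).
-/

namespace Summit.CriticalPhenomena.Ising3DConformalLimit.MoebiusLimitExistsNegative

open Literature.Probability.LatticeModels

/-- Every witness of the crux has `Δ ∈ [1/2, 1]` (Simon 1980 / Lieb 1980 lower bound,
Fröhlich–Simon–Spencer infrared bound, via `scalingDimension_mem_Icc_holds`). [cite: Simon1980, Thm. 1] -/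
theorem delta_mem_Icc_of_witness {ρ : ℝ → ℝ} {Δ : ℝ} {S : CorrFamily 3}
    (hρ : ∀ δ ∈ Set.Ioc (0:ℝ) 1, 0 < ρ δ)
    (hlim : HasPointwiseScalingLimit (criticalCorr 3) ρ S) (hnd : IsNondegenerateTwoPoint S)
    (hM : IsMoebiusCovariant Δ S) : Δ ∈ Set.Icc (1 / 2 : ℝ) 1 :=
  scalingDimension_mem_Icc_holds ρ Δ S hlim hM.isScaleCovariant hnd hρ

/-- REFUTED STRENGTHENING of the crux: no witness has `Δ < 1/2`. [cite: Simon1980, Thm. 1] -/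
theorem not_moebiusLimit_with_delta_lt_half :
    ¬ ∃ (ρ : ℝ → ℝ) (Δ : ℝ) (S : CorrFamily 3), (∀ δ ∈ Set.Ioc (0:ℝ) 1, 0 < ρ δ) ∧ 0 < Δ ∧
      HasPointwiseScalingLimit (criticalCorr 3) ρ S ∧ IsNondegenerateTwoPoint S ∧
        IsMoebiusCovariant Δ S ∧ Δ < 1 / 2 := by
  rintro ⟨ρ, Δ, S, hρ, -, hlim, hnd, hM, hΔ⟩
  exact absurd (delta_mem_Icc_of_witness hρ hlim hnd hM).1 (not_le.2 hΔ)

/-- REFUTED STRENGTHENING of the crux: no witness has `1 < Δ`. [cite: Simon1980, Thm. 1] -/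
theorem not_moebiusLimit_with_delta_gt_one :
    ¬ ∃ (ρ : ℝ → ℝ) (Δ : ℝ) (S : CorrFamily 3), (∀ δ ∈ Set.Ioc (0:ℝ) 1, 0 < ρ δ) ∧ 0 < Δ ∧
      HasPointwiseScalingLimit (criticalCorr 3) ρ S ∧ IsNondegenerateTwoPoint S ∧
        IsMoebiusCovariant Δ S ∧ 1 < Δ := by
  rintro ⟨ρ, Δ, S, hρ, -, hlim, hnd, hM, hΔ⟩
  exact absurd (delta_mem_Icc_of_witness hρ hlim hnd hM).2 (not_le.2 hΔ)

/-- The clause `0 < Δ` of the crux is REDUNDANT: the crux is equivalent to its version without it.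
[cite: Simon1980, Thm. 1] -/
theorem moebiusLimit_iff_without_delta_pos :
    Summit.CriticalPhenomena.Ising3DConformalLimit.Theses.EnergyNotSigmaSquared.MoebiusLimit ↔
      ∃ (ρ : ℝ → ℝ) (Δ : ℝ) (S : CorrFamily 3), (∀ δ ∈ Set.Ioc (0:ℝ) 1, 0 < ρ δ) ∧
        HasPointwiseScalingLimit (criticalCorr 3) ρ S ∧ IsNondegenerateTwoPoint S ∧
          IsMoebiusCovariant Δ S := by
  constructor
  · rintro ⟨ρ, Δ, S, h1, -, h3, h4, h5⟩
    exact ⟨ρ, Δ, S, h1, h3, h4, h5⟩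
  · rintro ⟨ρ, Δ, S, h1, h3, h4, h5⟩
    exact ⟨ρ, Δ, S, h1, by linarith [(delta_mem_Icc_of_witness h1 h3 h4 h5).1], h3, h4, h5⟩

end Summit.CriticalPhenomena.Ising3DConformalLimit.MoebiusLimitExistsNegative
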